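import Literature.NumberTheory.LFunctions.BaezDuarteIsometry
import HarnessLib

/-!
# Test vectors `t^{w̄-1}𝟙_{(0,1]}` against Nyman–Beurling approximants and Báez-Duarte's `U`

Topic `Literature/NumberTheory/LFunctions`. Third file of the proof of the
Báez-Duarte–Balazard–Landreau–Saias lower bound (`Literature.Barriers.RiemannHypothesis.BDBLS2000_uniform`). With
`f = χ - Σ c_j ρ_{a_j}` (`nbFun a c`), its reflection `f♯ = Uf` (`nbDual a c`) and the symbol
`U(s)` (`uSymbol`) of `BaezDuarteReflection.lean` / `BaezDuarteIsometry.lean`, and the test vectors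
`e_w(t) = t^{w̄-1} 𝟙_{(0,1]}(t)` (`testVec w`, `Re w > 1/2`; these are Burnol's `ψ_{1-w̄,0}`,
`ψ_{w,0}(t) = t^{-w}χ(t)`, Adv. Math. 2002, §4; Burnol, Forum Math. 2004, §5: "The first candidates
are `t ↦ t^{-ρ}` … The authors of [BDBLS] followed more or less this strategy [with the square
integrable vectors `t^{-(ρ-ε)}𝟙_{0<t<1}`]"), we prove:

* `integral_mul_conj_testVec` : `⟨h, e_w⟩ = ∫_0^1 h(t) t^{w-1} dt = M[h𝟙_{(0,1]}](w)`;
* `differentiableAt_mellin_indicator` : `w ↦ M[h𝟙_{(0,1]}](w)` is holomorphic on `Re w > 0` for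
  bounded measurable `h`;
* `exists_lipschitz_uSymbol` : `U` is Lipschitz on the closed disc of radius `1/4` about any point of
  the critical line;
* `norm_pairing_sub_le` (**the key estimate**): for `w = ρ + η` to the right of a point `ρ` of the
  critical line (`0 < η` small) and `c₀ = 1/U(w)`,
  `|⟨f, e_w⟩ - c₀⟨f♯, e_w⟩| ≤ ‖f‖₂ · √M`, with `M` depending only on `ρ` — uniformly in `η`, in the
  dilations and in the coefficients. Mechanism: by the polarized Mellin–Parseval identity and
  `M[f♯] = U·M[f]`, `2π(⟨f,e_w⟩ - c₀⟨f♯,e_w⟩) = ∫ M[f](s)(U(w)-U(s))/(U(w)(w-s)) dτ` (`s = 1/2+iτ`), and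
  the second factor is bounded in `L²(dτ)` independently of `η` because `U` is Lipschitz near `ρ`
  (this is the `L²`-content of Báez-Duarte's "`U t^{-w}𝟙 ≈ U(w)t^{-w}`", BDBLS Lemme 6 / Burnol Thm. 4.4,
  which is all that the lower bound needs).

## References

* L. Báez-Duarte, M. Balazard, B. Landreau, E. Saias, *Notes sur la fonction ζ de Riemann, 3*,
  Adv. Math. 149 (2000), 130–144 (Lemme 6).
* J.-F. Burnol, *A lower bound in an approximation problem involving the zeros of the Riemann zeta
  function*, Adv. Math. 170 (2002), 56–70, §4 (`ψ_{w,k}`), Thm. 4.4.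
* J.-F. Burnol, *On Fourier and Zeta(s)*, Forum Math. 16 (2004), 789–840, §5 (description of the
  BDBLS strategy with the vectors `t^{-(ρ-ε)}𝟙_{0<t<1}`).
-/

noncomputable section

open Complex MeasureTheory Set Filter Metric
open scoped Real Topology ComplexConjugate

namespace Literature.NumberTheory.LFunctions

namespace BaezDuarteU

/-! ## The test vectors `e_w` -/

/-- The test vector `e_w(t) = t^{w̄-1} 𝟙_{(0,1]}(t)` (in `L²(0,∞)` for `Re w > 1/2`); Burnol's
`ψ_{1-w̄,0}` where `ψ_{w,0}(t) = t^{-w}χ(t)`. [cite: Burnol2002, §4] -/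
def testVec (w : ℂ) : ℝ → ℂ :=
  (Ioc (0 : ℝ) 1).indicator fun t ↦ (t : ℂ) ^ (conj w - 1)

/-- `testVec w` is measurable. [folklore] -/
theorem measurable_testVec (w : ℂ) : Measurable (testVec w) :=
  (Complex.measurable_ofReal.pow_const _).indicator measurableSet_Ioc

/-- Mellin transform of `e_w`: `M[e_w](s) = 1/(s + w̄ - 1)` for `Re s + Re w > 1`. [folklore] -/
theorem hasMellin_testVec (w : ℂ) {s : ℂ} (hs : 1 < s.re + w.re) :
    HasMellin (testVec w) s (1 / (s + (conj w - 1))) :=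
  hasMellin_cpow_Ioc (conj w - 1) (by simp; linarith)

/-- `M[e_w]` converges absolutely at `1/2` when `Re w > 1/2`. [folklore] -/
theorem mellinConvergent_testVec_half {w : ℂ} (hw : 1 / 2 < w.re) :
    MellinConvergent (testVec w) (1 / 2) :=
  (hasMellin_testVec w (s := 1 / 2) (by simp; linarith)).1

/-- On the critical line, `conj(M[e_w](s)) = 1/(w - s)`. [folklore] -/
theorem conj_mellin_testVec {w : ℂ} (hw : 1 / 2 < w.re) (τ : ℝ) :
    conj (mellin (testVec w) (1 / 2 + τ * I)) = 1 / (w - (1 / 2 + τ * I)) := by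
  rw [(hasMellin_testVec w (s := 1 / 2 + τ * I) (by simp; linarith)).2]
  simp only [map_div₀, map_one, map_add, map_sub, Complex.conj_conj, Complex.conj_ofReal, map_mul,
    Complex.conj_I]
  rw [show (starRingEnd ℂ) (2 : ℂ) = 2 from map_ofNat _ 2]
  congr 1
  ring

/-- `e_w ∈ L²((0,∞))` for `Re w > 1/2` (`∫_0^1 t^{2Re w - 2} dt < ∞`). [folklore] -/
theorem integrableOn_norm_sq_testVec {w : ℂ} (hw : 1 / 2 < w.re) :
    IntegrableOn (fun t ↦ ‖testVec w t‖ ^ 2) (Ioi 0) := by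
  have h : IntegrableOn (fun t : ℝ ↦ t ^ (2 * w.re - 2)) (Ioc 0 1) :=
    (intervalIntegral.intervalIntegrable_rpow' (a := 0) (b := 1) (by linarith)).1
  have h2 : IntegrableOn ((Ioc (0 : ℝ) 1).indicator fun t : ℝ ↦ t ^ (2 * w.re - 2)) (Ioi 0) :=
    (h.integrable_indicator measurableSet_Ioc).integrableOn
  refine h2.congr_fun (fun t (ht : 0 < t) ↦ ?_) measurableSet_Ioi
  unfold testVec
  by_cases h1 : t ∈ Ioc (0 : ℝ) 1
  · rw [indicator_of_mem h1, indicator_of_mem h1, norm_cpow_eq_rpow_re_of_pos ht, ← Real.rpow_natCast,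
      ← Real.rpow_mul ht.le]
    congr 1
    simp
    ring
  · rw [indicator_of_notMem h1, indicator_of_notMem h1]
    simp

/-- `∫_0^1 t^{-1} · t^{2η} …`: the squared norm `‖e_w‖² = ∫_0^1 t^{2 Re w - 2} dt ≤ …` is not needed;
what is needed is the pairing formula: for `t > 0`, `conj(e_w(t)) = 𝟙_{(0,1]}(t) t^{w-1}`. [folklore] -/
theorem conj_testVec_apply (w : ℂ) {t : ℝ} (ht : 0 < t) :
    conj (testVec w t) = (Ioc (0 : ℝ) 1).indicator (fun t : ℝ ↦ (t : ℂ) ^ (w - 1)) t := by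
  unfold testVec
  by_cases h1 : t ∈ Ioc (0 : ℝ) 1
  · rw [indicator_of_mem h1, indicator_of_mem h1]
    have harg : ((t : ℂ)).arg ≠ π := by
      rw [Complex.arg_ofReal_of_nonneg ht.le]; exact Real.pi_ne_zero.symm
    have := Complex.cpow_conj (t : ℂ) (conj w - 1) harg
    rw [Complex.conj_ofReal] at this
    rw [← this]
    simp
  · rw [indicator_of_notMem h1, indicator_of_notMem h1, map_zero]

/-- **Pairing against `e_w` is a truncated Mellin transform**:
`∫_0^∞ h(t) conj(e_w(t)) dt = ∫_0^1 h(t) t^{w-1} dt = M[h 𝟙_{(0,1]}](w)`. [folklore] -/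
theorem integral_mul_conj_testVec (h : ℝ → ℂ) (w : ℂ) :
    ∫ t in Ioi (0 : ℝ), h t * conj (testVec w t) = mellin ((Ioc (0 : ℝ) 1).indicator h) w := by
  rw [mellin]
  refine setIntegral_congr_fun measurableSet_Ioi fun t (ht : 0 < t) ↦ ?_
  rw [conj_testVec_apply w ht]
  by_cases h1 : t ∈ Ioc (0 : ℝ) 1
  · rw [indicator_of_mem h1, indicator_of_mem h1, smul_eq_mul, mul_comm]
  · rw [indicator_of_notMem h1, indicator_of_notMem h1, mul_zero, smul_zero]

/-- Truncated Mellin transforms of bounded functions are holomorphic on `Re w > 0`: if `h` is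
measurable and `‖h‖ ≤ C` on `(0,1]`, then `w ↦ M[h𝟙_{(0,1]}](w)` is differentiable at every `w` with
`Re w > 0` (Mathlib `mellin_differentiableAt_of_isBigO_rpow`). [folklore] -/
theorem differentiableAt_mellin_indicator {h : ℝ → ℂ} (hm : Measurable h) {C : ℝ}
    (hC : ∀ t ∈ Ioc (0 : ℝ) 1, ‖h t‖ ≤ C) {w : ℂ} (hw : 0 < w.re) :
    DifferentiableAt ℂ (mellin ((Ioc (0 : ℝ) 1).indicator h)) w := by
  set g := (Ioc (0 : ℝ) 1).indicator h with hg
  have hgb : ∀ t, ‖g t‖ ≤ max C 0 := by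
    intro t
    by_cases h1 : t ∈ Ioc (0 : ℝ) 1
    · rw [hg, indicator_of_mem h1]; exact (hC t h1).trans (le_max_left _ _)
    · rw [hg, indicator_of_notMem h1, norm_zero]; exact le_max_right _ _
  have hgi : Integrable g := by
    have : g = (Ioc (0 : ℝ) 1).indicator g := by
      rw [hg, indicator_indicator, inter_self]
    rw [this, integrable_indicator_iff measurableSet_Ioc]
    refine Measure.integrableOn_of_bounded (M := max C 0) measure_Ioc_lt_top.ne
      ((hm.indicator measurableSet_Ioc).aestronglyMeasurable) ?_
    exact Eventually.of_forall fun t ↦ hgb t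
  refine mellin_differentiableAt_of_isBigO_rpow (a := w.re + 1) (b := 0)
    hgi.integrableOn.locallyIntegrableOn ?_ (by linarith) ?_ (by simpa using hw)
  · have h0 : g =ᶠ[atTop] 0 := by
      filter_upwards [eventually_gt_atTop 1] with t ht
      rw [hg, indicator_of_notMem (fun h' ↦ absurd h'.2 (not_le.2 ht))]
      rfl
    exact (Asymptotics.isBigO_zero _ _).congr' h0.symm EventuallyEq.rfl
  · refine Asymptotics.IsBigO.of_bound (max C 0) ?_
    filter_upwards [self_mem_nhdsWithin] with t (ht : 0 < t)
    simpa [Real.rpow_zero] using hgb t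

/-- Truncated Mellin transforms of bounded functions converge absolutely on `Re w > 0`. [folklore] -/
theorem mellinConvergent_indicator {h : ℝ → ℂ} (hm : Measurable h) {C : ℝ}
    (hC : ∀ t ∈ Ioc (0 : ℝ) 1, ‖h t‖ ≤ C) {w : ℂ} (hw : 0 < w.re) :
    MellinConvergent ((Ioc (0 : ℝ) 1).indicator h) w := by
  set g := (Ioc (0 : ℝ) 1).indicator h with hg
  have hgb : ∀ t, ‖g t‖ ≤ max C 0 := by
    intro t
    by_cases h1 : t ∈ Ioc (0 : ℝ) 1
    · rw [hg, indicator_of_mem h1]; exact (hC t h1).trans (le_max_left _ _)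
    · rw [hg, indicator_of_notMem h1, norm_zero]; exact le_max_right _ _
  have hgi : Integrable g := by
    have : g = (Ioc (0 : ℝ) 1).indicator g := by
      rw [hg, indicator_indicator, inter_self]
    rw [this, integrable_indicator_iff measurableSet_Ioc]
    refine Measure.integrableOn_of_bounded (M := max C 0) measure_Ioc_lt_top.ne
      ((hm.indicator measurableSet_Ioc).aestronglyMeasurable) ?_
    exact Eventually.of_forall fun t ↦ hgb t
  refine mellinConvergent_of_isBigO_rpow (a := w.re + 1) (b := 0)
    hgi.integrableOn.locallyIntegrableOn ?_ (by linarith) ?_ (by simpa using hw)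
  · have h0 : g =ᶠ[atTop] 0 := by
      filter_upwards [eventually_gt_atTop 1] with t ht
      rw [hg, indicator_of_notMem (fun h' ↦ absurd h'.2 (not_le.2 ht))]
      rfl
    exact (Asymptotics.isBigO_zero _ _).congr' h0.symm EventuallyEq.rfl
  · refine Asymptotics.IsBigO.of_bound (max C 0) ?_
    filter_upwards [self_mem_nhdsWithin] with t (ht : 0 < t)
    simpa [Real.rpow_zero] using hgb t

/-- The truncated Mellin transform as an integral over `(0,1]`:
`M[h𝟙_{(0,1]}](w) = ∫_{(0,1]} t^{w-1} h(t) dt`. [folklore] -/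
theorem mellin_indicator_eq_setIntegral (h : ℝ → ℂ) (w : ℂ) :
    mellin ((Ioc (0 : ℝ) 1).indicator h) w = ∫ t in Ioc (0 : ℝ) 1, (t : ℂ) ^ (w - 1) * h t := by
  have e : ∀ t : ℝ, (t : ℂ) ^ (w - 1) • (Ioc (0 : ℝ) 1).indicator h t =
      (Ioc (0 : ℝ) 1).indicator (fun t ↦ (t : ℂ) ^ (w - 1) * h t) t := by
    intro t
    by_cases h1 : t ∈ Ioc (0 : ℝ) 1
    · rw [indicator_of_mem h1, indicator_of_mem h1, smul_eq_mul]
    · rw [indicator_of_notMem h1, indicator_of_notMem h1, smul_zero]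
  rw [mellin]
  simp_rw [e]
  rw [setIntegral_indicator measurableSet_Ioc, inter_eq_right.2 Ioc_subset_Ioi_self]

/-- Continuity form: `η ↦ M[h𝟙_{(0,1]}](ρ + η)` tends to `M[h𝟙_{(0,1]}](ρ)` as `η → 0+`, `Re ρ > 0`.
[folklore] -/
theorem tendsto_mellin_indicator {h : ℝ → ℂ} (hm : Measurable h) {C : ℝ}
    (hC : ∀ t ∈ Ioc (0 : ℝ) 1, ‖h t‖ ≤ C) {ρ : ℂ} (hρ : 0 < ρ.re) :
    Tendsto (fun η : ℝ ↦ mellin ((Ioc (0 : ℝ) 1).indicator h) (ρ + η)) (𝓝[>] 0)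
      (𝓝 (mellin ((Ioc (0 : ℝ) 1).indicator h) ρ)) := by
  have hc := (differentiableAt_mellin_indicator hm hC hρ).continuousAt
  have h2 : Tendsto (fun η : ℝ ↦ ρ + (η : ℂ)) (𝓝 0) (𝓝 ρ) := by
    have : Continuous fun η : ℝ ↦ ρ + (η : ℂ) := by fun_prop
    simpa using this.tendsto 0
  exact (hc.tendsto.comp h2).mono_left nhdsWithin_le_nhds

/-! ## `U` is Lipschitz near the critical line -/

/-- The closed disc of radius `1/4` about a point of the critical line lies in the critical strip.
[folklore] -/
lemma closedBall_subset_strip (γ : ℝ) :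
    closedBall (1 / 2 + γ * I : ℂ) (1 / 4) ⊆ {s : ℂ | 0 < s.re ∧ s.re < 1} := by
  intro s hs
  rw [mem_closedBall, dist_eq_norm] at hs
  have h := (Complex.abs_re_le_norm (s - (1 / 2 + γ * I))).trans hs
  simp only [sub_re, add_re, mul_re, I_re, mul_zero, ofReal_im, I_im, mul_one,
    sub_self, add_zero, ofReal_re] at h
  norm_num at h
  rw [abs_le] at h
  exact ⟨by linarith [h.1, h.2], by linarith [h.1, h.2]⟩

/-- **`U` is Lipschitz near any point of the critical line**: there is `K > 0` with
`‖U(y) - U(x)‖ ≤ K‖y - x‖` for all `x, y` in the closed disc of radius `1/4` about `1/2 + iγ` (holomorphy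
of `U` on the strip, compactness, and the mean value inequality). [folklore] -/
theorem exists_lipschitz_uSymbol (γ : ℝ) : ∃ K : ℝ, 0 < K ∧
    ∀ x ∈ closedBall (1 / 2 + γ * I : ℂ) (1 / 4), ∀ y ∈ closedBall (1 / 2 + γ * I : ℂ) (1 / 4),
      ‖uSymbol y - uSymbol x‖ ≤ K * ‖y - x‖ := by
  set D := closedBall (1 / 2 + γ * I : ℂ) (1 / 4) with hD
  set U : Set ℂ := {s : ℂ | 0 < s.re ∧ s.re < 1} with hU
  have hDU : D ⊆ U := closedBall_subset_strip γ
  have hUo : IsOpen U := by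
    have : U = (Complex.re ⁻¹' Ioi 0) ∩ (Complex.re ⁻¹' Iio 1) := by
      ext s; simp [hU]
    rw [this]
    exact (isOpen_Ioi.preimage Complex.continuous_re).inter (isOpen_Iio.preimage Complex.continuous_re)
  have hdiff : DifferentiableOn ℂ uSymbol U := fun s hs ↦
    (differentiableAt_uSymbol hs.1 hs.2).differentiableWithinAt
  have han : AnalyticOnNhd ℂ uSymbol U := hdiff.analyticOnNhd hUo
  have hder : ContinuousOn (deriv uSymbol) D :=
    (han.deriv.continuousOn).mono hDU
  obtain ⟨K, hK⟩ := (isCompact_closedBall _ _).exists_bound_of_continuousOn hder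
  refine ⟨max K 1, by positivity, fun x hx y hy ↦ ?_⟩
  exact Convex.norm_image_sub_le_of_norm_deriv_le (f := uSymbol) (s := D) (C := max K 1)
    (fun z hz ↦ differentiableAt_uSymbol (hDU hz).1 (hDU hz).2)
    (fun z hz ↦ (hK z hz).trans (le_max_left K 1)) (convex_closedBall _ _) hx hy

/-! ## The key estimate -/

section key

variable {n : ℕ} (a c : Fin n → ℝ)

/-- The multiplier `B(τ) = (1 - U(s)/U(w))/(w - s)`, `s = 1/2 + iτ`, appearing in
`2π(⟨f,e_w⟩ - ⟨f♯,e_w⟩/U(w)) = ∫ M[f](s) B(τ) dτ` (used for `Re w > 1/2`, where `w - s ≠ 0`; for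
`w` on the line the value at `s = w` is the junk `x/0 = 0`). [folklore] -/
def bMult (w : ℂ) (τ : ℝ) : ℂ :=
  (1 - (uSymbol w)⁻¹ * uSymbol (1 / 2 + τ * I)) / (w - (1 / 2 + τ * I))

/-- `bMult w` is continuous in `τ` (`Re w > 1/2`). [folklore] -/
theorem continuous_bMult {w : ℂ} (hw : 1 / 2 < w.re) : Continuous (bMult w) := by
  unfold bMult
  have h1 : Continuous fun τ : ℝ ↦ uSymbol (1 / 2 + τ * I) := by
    refine continuousOn_uSymbol.comp_continuous (by fun_prop) fun τ ↦ ?_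
    constructor <;> norm_num
  refine Continuous.div (continuous_const.sub (continuous_const.mul h1)) (by fun_prop) fun τ h ↦ ?_
  have := congrArg Complex.re h
  simp at this
  linarith

/-- **Pointwise bound for the multiplier.** Let `ρ = 1/2 + iγ`, `U` `K`-Lipschitz on the closed
`1/4`-disc about `ρ`, `w = ρ + η` with `0 < η ≤ 1/4` and `‖U(w)‖ ≥ 1/2`. Then
`‖B(τ)‖² ≤ 2·max(4K², 77)/(1 + (τ-γ)²)`. [folklore] -/
theorem norm_sq_bMult_le {γ K η : ℝ} (hK : 0 < K)
    (hLip : ∀ x ∈ closedBall (1 / 2 + γ * I : ℂ) (1 / 4), ∀ y ∈ closedBall (1 / 2 + γ * I : ℂ) (1 / 4),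
      ‖uSymbol y - uSymbol x‖ ≤ K * ‖y - x‖)
    (hη0 : 0 < η) (hη1 : η ≤ 1 / 4) (hUw : 1 / 2 ≤ ‖uSymbol (1 / 2 + γ * I + η)‖) (τ : ℝ) :
    ‖bMult (1 / 2 + γ * I + η) τ‖ ^ 2 ≤ 2 * max (4 * K ^ 2) 77 / (1 + (τ - γ) ^ 2) := by
  set w : ℂ := 1 / 2 + γ * I + η with hw
  set s : ℂ := 1 / 2 + τ * I with hs
  have hUw0 : uSymbol w ≠ 0 := by
    intro h; rw [h, norm_zero] at hUw; norm_num at hUw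
  have hws : w - s = ((η : ℝ) : ℂ) + ((γ - τ : ℝ) : ℂ) * I := by
    simp only [hw, hs]; push_cast; ring
  have hnorm_ws : ‖w - s‖ ^ 2 = η ^ 2 + (γ - τ) ^ 2 := by
    rw [hws, ← Complex.normSq_eq_norm_sq, Complex.normSq_add_mul_I]
  have hws0 : w - s ≠ 0 := by
    intro h
    have : ‖w - s‖ ^ 2 = 0 := by rw [h, norm_zero]; ring
    rw [hnorm_ws] at this
    nlinarith [sq_nonneg (γ - τ)]
  -- rewrite `B` as `(U w - U s)/(U w (w - s))`
  have hB : bMult w τ = (uSymbol w - uSymbol s) / (uSymbol w * (w - s)) := by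
    unfold bMult
    rw [← hs]
    field_simp
  have hBn : ‖bMult w τ‖ = ‖uSymbol w - uSymbol s‖ / (‖uSymbol w‖ * ‖w - s‖) := by
    rw [hB, norm_div, norm_mul]
  have hMpos : (0 : ℝ) < max (4 * K ^ 2) 77 := lt_max_of_lt_right (by norm_num)
  have hden : 0 < 1 + (τ - γ) ^ 2 := by positivity
  have hUs : ‖uSymbol s‖ = 1 := by rw [hs]; exact norm_uSymbol_half τ
  by_cases hτ : |τ - γ| ≤ 1 / 4
  · -- near the zero: Lipschitz
    have hsD : s ∈ closedBall (1 / 2 + γ * I : ℂ) (1 / 4) := by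
      rw [mem_closedBall, dist_eq_norm, hs,
        show (1 / 2 + τ * I - (1 / 2 + γ * I) : ℂ) = ((τ - γ : ℝ) : ℂ) * I by push_cast; ring,
        norm_mul, Complex.norm_I, mul_one, Complex.norm_real, Real.norm_eq_abs]
      exact hτ
    have hwD : w ∈ closedBall (1 / 2 + γ * I : ℂ) (1 / 4) := by
      rw [mem_closedBall, dist_eq_norm, hw, add_sub_cancel_left, Complex.norm_real, Real.norm_eq_abs,
        abs_of_pos hη0]
      exact hη1
    have hL := hLip s hsD w hwD
    have h1 : ‖bMult w τ‖ ≤ 2 * K := by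
      rw [hBn, div_le_iff₀ (by positivity)]
      calc ‖uSymbol w - uSymbol s‖ ≤ K * ‖w - s‖ := hL
        _ ≤ K * ‖w - s‖ * (2 * ‖uSymbol w‖) := by
            refine le_mul_of_one_le_right (by positivity) ?_; linarith
        _ = 2 * K * (‖uSymbol w‖ * ‖w - s‖) := by ring
    have h2 : ‖bMult w τ‖ ^ 2 ≤ 4 * K ^ 2 := by nlinarith [norm_nonneg (bMult w τ)]
    calc ‖bMult w τ‖ ^ 2 ≤ 4 * K ^ 2 := h2
      _ ≤ max (4 * K ^ 2) 77 := le_max_left _ _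
      _ ≤ 2 * max (4 * K ^ 2) 77 / (1 + (τ - γ) ^ 2) := by
          rw [le_div_iff₀ hden]
          have : (τ - γ) ^ 2 ≤ 1 / 16 := by
            have := abs_le.1 hτ; nlinarith [this.1, this.2]
          nlinarith [hMpos.le]
  · -- far from the zero: `|w - s| ≥ |τ - γ| > 1/4`
    rw [not_le] at hτ
    have hdist : |τ - γ| ≤ ‖w - s‖ := by
      have h1 : (τ - γ) ^ 2 ≤ ‖w - s‖ ^ 2 := by rw [hnorm_ws]; nlinarith
      exact abs_le_of_sq_le_sq' h1 (norm_nonneg _) |>.2 |> fun h ↦ by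
        rw [abs_le]; constructor
        · have := (abs_le_of_sq_le_sq' h1 (norm_nonneg _)).1; linarith
        · exact h
    have h1 : ‖bMult w τ‖ ≤ 3 / |τ - γ| := by
      rw [hBn, div_le_div_iff₀ (by positivity) (by positivity)]
      calc ‖uSymbol w - uSymbol s‖ * |τ - γ| ≤ (‖uSymbol w‖ + ‖uSymbol s‖) * ‖w - s‖ :=
            mul_le_mul (norm_sub_le _ _) hdist (abs_nonneg _) (by positivity)
        _ = (‖uSymbol w‖ + 1) * ‖w - s‖ := by rw [hUs]
        _ ≤ 3 * (‖uSymbol w‖ * ‖w - s‖) := by nlinarith [norm_nonneg (w - s)]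
    have h2 : ‖bMult w τ‖ ^ 2 ≤ 9 / (τ - γ) ^ 2 := by
      have h0 : 0 ≤ ‖bMult w τ‖ := norm_nonneg _
      have hτ0 : 0 < |τ - γ| := by linarith
      calc ‖bMult w τ‖ ^ 2 ≤ (3 / |τ - γ|) ^ 2 := pow_le_pow_left₀ h0 h1 2
        _ = 9 / (τ - γ) ^ 2 := by rw [div_pow, sq_abs]; norm_num
    calc ‖bMult w τ‖ ^ 2 ≤ 9 / (τ - γ) ^ 2 := h2
      _ ≤ 2 * max (4 * K ^ 2) 77 / (1 + (τ - γ) ^ 2) := by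
          have hx : 1 / 16 < (τ - γ) ^ 2 := by
            have : 1 / 4 < |τ - γ| := hτ
            have h4 : (1 / 4 : ℝ) ^ 2 < |τ - γ| ^ 2 := by gcongr
            rw [sq_abs] at h4; norm_num at h4; exact h4
          have hx0 : 0 < (τ - γ) ^ 2 := by linarith
          rw [div_le_div_iff₀ hx0 hden]
          have hM : (77 : ℝ) ≤ max (4 * K ^ 2) 77 := le_max_right _ _
          nlinarith

/-- **The key estimate.** Let `ρ = 1/2 + iγ`, `U` `K`-Lipschitz on the closed `1/4`-disc about `ρ`,
`w = ρ + η` with `0 < η ≤ 1/4` and `‖U(w)‖ ≥ 1/2`, `c₀ = 1/U(w)`, `a_j ≥ 1`. Then for `f = nbFun a c`,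
`f♯ = nbDual a c`:
`‖∫_0^∞ (f - c₀ f♯) conj(e_w)‖ ≤ √(∫_0^∞ |f|²) · √(max(4K², 77))`,
uniformly in `η`: polarized Mellin–Parseval, `M[f♯] = U M[f]`, Cauchy–Schwarz and
`Literature.NumberTheory.LFunctions.BaezDuarteU.norm_sq_bMult_le` (`∫ dτ/(1+(τ-γ)²) = π`). This is the `L²` substitute for the pointwise
"`U(t^{-w}𝟙) = U(w)t^{-w} + O(1)`" of BDBLS (Burnol 2002, Thm. 4.4). [folklore] -/
theorem norm_pairing_sub_le (ha : ∀ j, 1 ≤ a j) {γ K η : ℝ} (hK : 0 < K)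
    (hLip : ∀ x ∈ closedBall (1 / 2 + γ * I : ℂ) (1 / 4), ∀ y ∈ closedBall (1 / 2 + γ * I : ℂ) (1 / 4),
      ‖uSymbol y - uSymbol x‖ ≤ K * ‖y - x‖)
    (hη0 : 0 < η) (hη1 : η ≤ 1 / 4) (hUw : 1 / 2 ≤ ‖uSymbol (1 / 2 + γ * I + η)‖) :
    ‖∫ t in Ioi (0 : ℝ), (nbFun a c t - (uSymbol (1 / 2 + γ * I + η))⁻¹ * nbDual a c t) *
        conj (testVec (1 / 2 + γ * I + η) t)‖ ≤
      Real.sqrt (∫ t in Ioi (0 : ℝ), ‖nbFun a c t‖ ^ 2) * Real.sqrt (max (4 * K ^ 2) 77) := by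
  set w : ℂ := 1 / 2 + γ * I + η with hw
  set c₀ : ℂ := (uSymbol w)⁻¹ with hc₀
  have hwre : 1 / 2 < w.re := by simp [hw, hη0]
  have ha0 : ∀ j, 0 < a j := fun j ↦ by linarith [ha j]
  -- the function `k = f - c₀ f♯`
  set k : ℝ → ℂ := fun t ↦ nbFun a c t + (-c₀) * nbDual a c t with hk
  have hk_eq : ∀ t, nbFun a c t - c₀ * nbDual a c t = k t := fun t ↦ by simp [hk]; ring
  have hfm := (measurable_nbFun a c).aestronglyMeasurable (μ := volume.restrict (Ioi 0))
  have hgm := (measurable_nbDual a c).aestronglyMeasurable (μ := volume.restrict (Ioi 0))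
  obtain ⟨hkconv, hkL2, hklin⟩ := polar_aux hfm hgm (mellinConvergent_nbFun_half a c ha)
    (mellinConvergent_nbDual_half a c ha) (integrableOn_norm_sq_nbFun a c ha)
    (integrableOn_norm_sq_nbDual a c ha) (-c₀)
  have hkm : AEStronglyMeasurable k (volume.restrict (Ioi 0)) := hfm.add (hgm.const_mul _)
  -- polarized Parseval for `(k, e_w)`
  have hem := (measurable_testVec w).aestronglyMeasurable (μ := volume.restrict (Ioi 0))
  obtain ⟨-, hP⟩ := integral_mellin_mul_conj hkm hem hkconv (mellinConvergent_testVec_half hwre)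
    hkL2 (integrableOn_norm_sq_testVec hwre)
  -- the integrand on the line is `M[f](s) B(τ)`
  set Mf : ℝ → ℂ := fun τ ↦ mellin (nbFun a c) (1 / 2 + τ * I) with hMf
  have hline : ∀ τ : ℝ, mellin k (1 / 2 + τ * I) * conj (mellin (testVec w) (1 / 2 + τ * I)) =
      Mf τ * bMult w τ := by
    intro τ
    rw [hklin τ, mellin_nbDual_eq a c ha0 (by simp) (by simp; norm_num), conj_mellin_testVec hwre,
      bMult, hc₀, hw]
    ring
  have hP' : ∫ τ : ℝ, Mf τ * bMult w τ = 2 * π * ∫ t in Ioi (0 : ℝ), k t * conj (testVec w t) := by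
    rw [← hP]
    exact integral_congr_ae (Eventually.of_forall fun τ ↦ (hline τ).symm)
  simp_rw [hk_eq]
  rw [show (∫ t in Ioi (0 : ℝ), k t * conj (testVec w t)) =
      (1 / (2 * π) : ℂ) * ∫ τ : ℝ, Mf τ * bMult w τ by
    rw [hP']
    have : (2 * π : ℂ) ≠ 0 := by exact_mod_cast (by positivity : (0 : ℝ) < 2 * π).ne'
    field_simp]
  -- Cauchy–Schwarz
  have hIf : Integrable (fun τ : ℝ ↦ ‖Mf τ‖ ^ 2) ∧ ∫ τ : ℝ, ‖Mf τ‖ ^ 2 =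
      2 * π * ∫ t in Ioi (0 : ℝ), ‖nbFun a c t‖ ^ 2 :=
    Literature.Analysis.FunctionSpaces.integral_norm_sq_mellin_half_eq
      (mellinConvergent_nbFun_half a c ha) (integrableOn_norm_sq_nbFun a c ha)
  set M : ℝ := max (4 * K ^ 2) 77 with hM
  have hMpos : 0 < M := lt_max_of_lt_right (by norm_num)
  have hBsq : ∀ τ, ‖bMult w τ‖ ^ 2 ≤ 2 * M / (1 + (τ - γ) ^ 2) := fun τ ↦
    norm_sq_bMult_le hK hLip hη0 hη1 hUw τ
  have hbint : Integrable fun τ : ℝ ↦ 2 * M / (1 + (τ - γ) ^ 2) := by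
    have h1 : Integrable fun τ : ℝ ↦ (1 + (τ - γ) ^ 2)⁻¹ :=
      integrable_inv_one_add_sq.comp_sub_right γ
    have := h1.const_mul (2 * M)
    refine this.congr (Eventually.of_forall fun τ ↦ ?_)
    simp [div_eq_mul_inv]
  have hbval : ∫ τ : ℝ, 2 * M / (1 + (τ - γ) ^ 2) = 2 * M * π := by
    have e : (fun τ : ℝ ↦ 2 * M / (1 + (τ - γ) ^ 2)) = fun τ ↦ 2 * M * (fun x : ℝ ↦ (1 + x ^ 2)⁻¹) (τ - γ) := by
      funext τ; simp [div_eq_mul_inv]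
    rw [e, integral_const_mul, integral_sub_right_eq_self (fun x : ℝ ↦ (1 + x ^ 2)⁻¹) γ,
      integral_univ_inv_one_add_sq]
  have hBcont : Continuous (bMult w) := continuous_bMult hwre
  have hBL2 : Integrable (fun τ : ℝ ↦ ‖bMult w τ‖ ^ 2) :=
    Integrable.mono' hbint (hBcont.norm.pow 2).aestronglyMeasurable
      (Eventually.of_forall fun τ ↦ by
        rw [Real.norm_eq_abs, abs_of_nonneg (by positivity)]; exact hBsq τ)
  have hMfcont : Continuous Mf := continuous_mellin_half (mellinConvergent_nbFun_half a c ha)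
  have hCS : ∫ τ : ℝ, ‖Mf τ‖ * ‖bMult w τ‖ ≤
      (∫ τ : ℝ, ‖Mf τ‖ ^ 2) ^ (1 / 2 : ℝ) * (∫ τ : ℝ, ‖bMult w τ‖ ^ 2) ^ (1 / 2 : ℝ) := by
    have h := integral_mul_le_Lp_mul_Lq_of_nonneg (μ := volume) Real.HolderConjugate.two_two
      (f := fun τ : ℝ ↦ ‖Mf τ‖) (g := fun τ : ℝ ↦ ‖bMult w τ‖)
      (Eventually.of_forall fun τ ↦ norm_nonneg _) (Eventually.of_forall fun τ ↦ norm_nonneg _)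
      (by
        rw [ENNReal.ofReal_ofNat]
        exact (memLp_two_iff_integrable_sq_norm hMfcont.norm.aestronglyMeasurable).2
          (by simpa using hIf.1))
      (by
        rw [ENNReal.ofReal_ofNat]
        exact (memLp_two_iff_integrable_sq_norm hBcont.norm.aestronglyMeasurable).2
          (by simpa using hBL2))
    simpa only [Real.rpow_two] using h
  -- assemble
  have hnorm : ‖∫ τ : ℝ, Mf τ * bMult w τ‖ ≤ Real.sqrt (2 * π * ∫ t in Ioi (0 : ℝ), ‖nbFun a c t‖ ^ 2) *
      Real.sqrt (2 * M * π) := by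
    calc ‖∫ τ : ℝ, Mf τ * bMult w τ‖ ≤ ∫ τ : ℝ, ‖Mf τ * bMult w τ‖ := norm_integral_le_integral_norm _
      _ = ∫ τ : ℝ, ‖Mf τ‖ * ‖bMult w τ‖ := by simp_rw [norm_mul]
      _ ≤ (∫ τ : ℝ, ‖Mf τ‖ ^ 2) ^ (1 / 2 : ℝ) * (∫ τ : ℝ, ‖bMult w τ‖ ^ 2) ^ (1 / 2 : ℝ) := hCS
      _ ≤ Real.sqrt (2 * π * ∫ t in Ioi (0 : ℝ), ‖nbFun a c t‖ ^ 2) * Real.sqrt (2 * M * π) := by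
          rw [← Real.sqrt_eq_rpow, ← Real.sqrt_eq_rpow, hIf.2]
          refine mul_le_mul_of_nonneg_left (Real.sqrt_le_sqrt ?_) (Real.sqrt_nonneg _)
          rw [← hbval]
          exact integral_mono_of_nonneg (Eventually.of_forall fun τ ↦ by positivity) hbint
            (Eventually.of_forall hBsq)
  have h2π : (0 : ℝ) < 2 * π := by positivity
  have hI0 : 0 ≤ ∫ t in Ioi (0 : ℝ), ‖nbFun a c t‖ ^ 2 := integral_nonneg fun t ↦ by positivity
  rw [norm_mul, show ‖(1 / (2 * π) : ℂ)‖ = 1 / (2 * π) by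
    rw [show (1 / (2 * π) : ℂ) = ((1 / (2 * π) : ℝ) : ℂ) by push_cast; ring, Complex.norm_real,
      Real.norm_eq_abs, abs_of_pos (by positivity)]]
  calc 1 / (2 * π) * ‖∫ τ : ℝ, Mf τ * bMult w τ‖
      ≤ 1 / (2 * π) * (Real.sqrt (2 * π * ∫ t in Ioi (0 : ℝ), ‖nbFun a c t‖ ^ 2) * Real.sqrt (2 * M * π)) :=
        mul_le_mul_of_nonneg_left hnorm (by positivity)
    _ = Real.sqrt (∫ t in Ioi (0 : ℝ), ‖nbFun a c t‖ ^ 2) * Real.sqrt M := by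
        rw [Real.sqrt_mul h2π.le, show 2 * M * π = (2 * π) * M by ring, Real.sqrt_mul h2π.le]
        have hs : Real.sqrt (2 * π) ^ 2 = 2 * π := Real.sq_sqrt h2π.le
        have hs0 : 0 < Real.sqrt (2 * π) := Real.sqrt_pos.2 h2π
        field_simp
        nlinarith [hs, Real.sqrt_nonneg (∫ t in Ioi (0 : ℝ), ‖nbFun a c t‖ ^ 2), Real.sqrt_nonneg M]

end key

end BaezDuarteU

end Literature.NumberTheory.LFunctions
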